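import Literature.Computability.Complexity.GraphCanonizationProgramFPParts
import Literature.Computability.Complexity.CodeFPOrderKit
import Literature.Computability.Complexity.LexCompareBricks
import HarnessLib

/-!
# The canoniser as a list program is typed polynomial time, IV: comparisons of keys and codes of frames

Two preparations for the certificate of the machine transition (`GraphCanonizationProgramFPStep.lean`):

* the ORDER TESTS the machine uses, as Boolean programs with `CodeFP` certificates and proofs that
  they decide the Lean orders on `CGCanon.Code = Lex (List (List Bool) × List ℕ)`,
  `CGProg.LCand = Lex (Code × Lex (ℕ × List ℕ))` and `Lex (Code × List ℕ)` (the keys of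
  candidates and of finished parts): rows by the brick `LexCmp.lexLeFn` (`codeFP_rowLe`), lists of
  rows and of numerals by `CodeFP.lexDecide` (`CodeFPOrderKit.lean`), then `ltCodeB`, `leCandB`,
  `lePKeyB`;
* the CODE OF FRAMES `CGProg.frameE` (a tagged record of ten fields, `CGProg.tupleOf`), with the
  codes of the three constructors (`frameE_indiv`, `frameE_sect`, `frameE_ret`).

## References

* S. Arora, B. Barak, *Computational Complexity: A Modern Approach*, CUP 2009, §1.3, §0.1. [AroraBarakCC2009]
-/

namespace Literature.Computability.Complexity

open _root_.Computability CodeFP Polynomial CGCanon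

namespace CGProg

/-! ### Order tests -/

/-- `<` on bit rows. [folklore] -/
def ltRowB (u v : List Bool) : Bool := !decide (v ≤ u)

/-- `ltRowB` decides `<`. [folklore] -/
theorem ltRowB_eq (u v : List Bool) : ltRowB u v = decide (u < v) := by rw [ltRowB, Bool.eq_iff_iff]; simp [not_le]

/-- Lexicographic `<` on lists of bit rows. [folklore] -/
def ltRowsB : List (List Bool) → List (List Bool) → Bool := lexDecide ltRowB fun a b => decide (a = b)

/-- `ltRowsB` decides `<`. [folklore] -/
theorem ltRowsB_eq (u v : List (List Bool)) : ltRowsB u v = decide (u < v) := by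
  unfold ltRowsB
  exact (lexDecide_eq (lt := ltRowB) (eq := fun a b => decide (a = b)) (fun a b => (ltRowB_eq a b).trans (decide_eq_decide.2 Iff.rfl))
    (fun _ _ => decide_eq_decide.2 Iff.rfl) u v).trans (decide_eq_decide.2 Iff.rfl)

/-- Lexicographic `<` on lists of numerals. [folklore] -/
def ltNatsB : List ℕ → List ℕ → Bool := lexDecide (fun a b => decide (a < b)) fun a b => decide (a = b)

/-- `ltNatsB` decides `<`. [folklore] -/
theorem ltNatsB_eq (u v : List ℕ) : ltNatsB u v = decide (u < v) := by
  unfold ltNatsB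
  exact (lexDecide_eq (lt := fun a b => decide (a < b)) (eq := fun a b => decide (a = b)) (fun _ _ => decide_eq_decide.2 Iff.rfl)
    (fun _ _ => decide_eq_decide.2 Iff.rfl) u v).trans (decide_eq_decide.2 Iff.rfl)

/-- `<` on codes (rows, then colours). [folklore] -/
def ltCodeB (a b : List (List Bool) × List ℕ) : Bool := ltRowsB a.1 b.1 || (decide (a.1 = b.1) && ltNatsB a.2 b.2)

/-- `ltCodeB` decides `<` on `Code`. [folklore] -/
theorem ltCodeB_eq (a b : List (List Bool) × List ℕ) : ltCodeB a b = decide ((toLex a : Code) < toLex b) := by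
  rw [Bool.eq_iff_iff, decide_eq_true_iff, Prod.Lex.toLex_lt_toLex]
  simp [ltCodeB, ltRowsB_eq, ltNatsB_eq]

/-- The data of a candidate: `((rows, colours), (vertex, ordering))`. [folklore] -/
abbrev LCandT : Type := (List (List Bool) × List ℕ) × (ℕ × List ℕ)

/-- A candidate from its data. [folklore] -/
def candOfT (a : LCandT) : LCand := toLex (toLex a.1, toLex a.2)

/-- The data of a candidate. [folklore] -/
def dataOfCand (b : LCand) : LCandT := (ofLex (ofLex b).1, ofLex (ofLex b).2)

/-- Round trip. [folklore] -/
@[simp] theorem candOfT_dataOfCand (b : LCand) : candOfT (dataOfCand b) = b := rfl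

/-- Round trip. [folklore] -/
@[simp] theorem dataOfCand_candOfT (a : LCandT) : dataOfCand (candOfT a) = a := rfl

/-- `<` on candidate data. [folklore] -/
def ltCandB (a b : LCandT) : Bool :=
  ltCodeB a.1 b.1 || (decide (a.1 = b.1) && (decide (a.2.1 < b.2.1) || (decide (a.2.1 = b.2.1) && ltNatsB a.2.2 b.2.2)))

/-- `ltCandB` decides `<` on `LCand`. [folklore] -/
theorem ltCandB_eq (a b : LCandT) : ltCandB a b = decide (candOfT a < candOfT b) := by
  rw [Bool.eq_iff_iff, decide_eq_true_iff, candOfT, candOfT]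
  simp [ltCandB, ltCodeB_eq, ltNatsB_eq, Prod.Lex.toLex_lt_toLex]

/-- `≤` on candidate data. [folklore] -/
def leCandB (a b : LCandT) : Bool := !ltCandB b a

/-- `leCandB` decides `≤` on `LCand`. [folklore] -/
theorem leCandB_eq (a b : LCandT) : leCandB a b = decide (candOfT a ≤ candOfT b) := by
  rw [leCandB, ltCandB_eq, Bool.eq_iff_iff]; simp [not_lt]

/-- The data of the key of a finished part: `((rows, colours), sorted vertices)`. [folklore] -/
abbrev PKeyT : Type := (List (List Bool) × List ℕ) × List ℕ

/-- A key from its data. [folklore] -/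
def pkeyOfT (a : PKeyT) : Lex (Code × List ℕ) := toLex (toLex a.1, a.2)

/-- `≤` on key data. [folklore] -/
def lePKeyB (a b : PKeyT) : Bool := !(ltCodeB b.1 a.1 || (decide (b.1 = a.1) && ltNatsB b.2 a.2))

/-- `lePKeyB` decides `≤`. [folklore] -/
theorem lePKeyB_eq (a b : PKeyT) : lePKeyB a b = decide (pkeyOfT a ≤ pkeyOfT b) := by
  have key : (pkeyOfT a ≤ pkeyOfT b) ↔ ¬ ((toLex b.1 : Code) < toLex a.1 ∨ (b.1 = a.1 ∧ b.2 < a.2)) := by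
    rw [← not_lt, pkeyOfT, pkeyOfT, Prod.Lex.toLex_lt_toLex, toLex_inj]
  rw [Bool.eq_iff_iff, decide_eq_true_iff, key, lePKeyB, Bool.not_eq_true', Bool.eq_false_iff, ne_eq, Bool.or_eq_true, Bool.and_eq_true,
    ltCodeB_eq, ltNatsB_eq, decide_eq_true_iff, decide_eq_true_iff, decide_eq_true_iff]

/-! ### Their certificates -/

/-- The code of a code. [folklore] -/
abbrev codeTE : List (List Bool) × List ℕ → List Bool := pairE (rawE strE) (rawE natE)

/-- The code of candidate data. [folklore] -/
abbrev candTE : LCandT → List Bool := pairE codeTE (pairE natE (rawE natE))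

/-- The code of key data. [folklore] -/
abbrev pkeyTE : PKeyT → List Bool := pairE codeTE (rawE natE)

/-- `codeTE` is injective (`strE` is the identity code). [folklore] -/
theorem codeTE_injective : Function.Injective codeTE :=
  pairE_injective (rawE_injective (e := strE) fun _ _ h => h) (rawE_injective natE_injective)

/-- `≤` on bit rows is typed polynomial time (the brick `LexCmp.lexLeFn`). [cite: AroraBarakCC2009, §1.3] -/
theorem codeFP_rowLe : CodeFP (pairE strE strE) bitE (fun p => decide (p.1 ≤ p.2)) :=
  ⟨LexCmp.lexLeFn, LexCmp.lexLeFn_mem_FP, fun p => LexCmp.lexLeFn_boolPair p.1 p.2⟩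

/-- `ltRowsB` is typed polynomial time. [cite: AroraBarakCC2009, §1.3] -/
theorem codeFP_ltRowsB : CodeFP (pairE (rawE strE) (rawE strE)) bitE (fun p => ltRowsB p.1 p.2) := by
  have hlt : CodeFP (pairE unitE (pairE strE strE)) bitE (fun t => ltRowB t.2.1 t.2.2) :=
    (codeFP_rowLe.comp ((snd _ _).snd'.pair (snd _ _).fst')).not.congr fun _ => rfl
  have heq : CodeFP (pairE unitE (pairE strE strE)) bitE (fun t => decide (t.2.1 = t.2.2)) := (eq (eα := strE) fun _ _ h => h).comp (snd _ _)
  have h := lexLt (σ := Unit) (eσ := unitE) (eα := strE) (lt := fun _ => ltRowB) (eq := fun _ a b => decide (a = b)) hlt heq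
  exact (h.comp ((const _ ()).pair (CodeFP.id _))).congr fun _ => rfl

/-- `ltNatsB` is typed polynomial time. [cite: AroraBarakCC2009, §1.3] -/
theorem codeFP_ltNatsB : CodeFP (pairE (rawE natE) (rawE natE)) bitE (fun p => ltNatsB p.1 p.2) := by
  have hlt : CodeFP (pairE unitE (pairE natE natE)) bitE (fun t => decide (t.2.1 < t.2.2)) := natLt.comp (snd _ _)
  have heq : CodeFP (pairE unitE (pairE natE natE)) bitE (fun t => decide (t.2.1 = t.2.2)) := natEq.comp (snd _ _)
  have h := lexLt (σ := Unit) (eσ := unitE) (eα := natE) (lt := fun _ a b => decide (a < b)) (eq := fun _ a b => decide (a = b)) hlt heq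
  exact (h.comp ((const _ ()).pair (CodeFP.id _))).congr fun _ => rfl

/-- `ltCodeB` is typed polynomial time. [cite: AroraBarakCC2009, §1.3] -/
theorem codeFP_ltCodeB : CodeFP (pairE codeTE codeTE) bitE (fun p => ltCodeB p.1 p.2) := by
  have h1 : CodeFP (pairE codeTE codeTE) bitE (fun p => ltRowsB p.1.1 p.2.1) := (codeFP_ltRowsB.comp ((fst _ _).fst'.pair (snd _ _).fst')).congr fun _ => rfl
  have h2 : CodeFP (pairE codeTE codeTE) bitE (fun p => decide (p.1.1 = p.2.1)) := (eq (rawE_injective (e := strE) fun _ _ h => h)).comp ((fst _ _).fst'.pair (snd _ _).fst')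
  have h3 : CodeFP (pairE codeTE codeTE) bitE (fun p => ltNatsB p.1.2 p.2.2) := (codeFP_ltNatsB.comp ((fst _ _).snd'.pair (snd _ _).snd')).congr fun _ => rfl
  exact (h1.or (h2.and h3)).congr fun _ => rfl

/-- `leCandB` is typed polynomial time. [cite: AroraBarakCC2009, §1.3] -/
theorem codeFP_leCandB : CodeFP (pairE candTE candTE) bitE (fun p => leCandB p.1 p.2) := by
  -- `ltCandB` on `(b, a)` = `(p.2, p.1)`
  let κ : LCandT × LCandT → List Bool := pairE candTE candTE
  have hb : CodeFP κ candTE (fun p => p.2) := snd _ _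
  have ha : CodeFP κ candTE (fun p => p.1) := fst _ _
  have h1 : CodeFP κ bitE (fun p => ltCodeB p.2.1 p.1.1) := (codeFP_ltCodeB.comp (hb.fst'.pair ha.fst')).congr fun _ => rfl
  have h2 : CodeFP κ bitE (fun p => decide (p.2.1 = p.1.1)) := (eq codeTE_injective).comp (hb.fst'.pair ha.fst')
  have h3 : CodeFP κ bitE (fun p => decide (p.2.2.1 < p.1.2.1)) := natLt.comp (hb.snd'.fst'.pair ha.snd'.fst')
  have h4 : CodeFP κ bitE (fun p => decide (p.2.2.1 = p.1.2.1)) := natEq.comp (hb.snd'.fst'.pair ha.snd'.fst')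
  have h5 : CodeFP κ bitE (fun p => ltNatsB p.2.2.2 p.1.2.2) := (codeFP_ltNatsB.comp (hb.snd'.snd'.pair ha.snd'.snd')).congr fun _ => rfl
  exact (h1.or (h2.and (h3.or (h4.and h5)))).not.congr fun _ => rfl

/-- `lePKeyB` is typed polynomial time. [cite: AroraBarakCC2009, §1.3] -/
theorem codeFP_lePKeyB : CodeFP (pairE pkeyTE pkeyTE) bitE (fun p => lePKeyB p.1 p.2) := by
  let κ : PKeyT × PKeyT → List Bool := pairE pkeyTE pkeyTE
  have hb : CodeFP κ pkeyTE (fun p => p.2) := snd _ _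
  have ha : CodeFP κ pkeyTE (fun p => p.1) := fst _ _
  have h1 : CodeFP κ bitE (fun p => ltCodeB p.2.1 p.1.1) := (codeFP_ltCodeB.comp (hb.fst'.pair ha.fst')).congr fun _ => rfl
  have h2 : CodeFP κ bitE (fun p => decide (p.2.1 = p.1.1)) := (eq codeTE_injective).comp (hb.fst'.pair ha.fst')
  have h3 : CodeFP κ bitE (fun p => ltNatsB p.2.2 p.1.2) := (codeFP_ltNatsB.comp (hb.snd'.pair ha.snd')).congr fun _ => rfl
  exact (h1.or (h2.and h3)).not.congr fun _ => rfl

/-! ### Codes of frames -/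

/-- The record behind a frame: tag (`0` individualization, `1` section, `2` finished), mask,
colours, running vertex, vertices to do, least candidate, running part, parts to do, finished
parts with their orderings, returned ordering (unused fields empty). [cite: AroraBarakCC2009, §0.1] -/
abbrev FTuple : Type :=
  ℕ × (List Bool × (List ℕ × (Option ℕ × (List ℕ × (Option LCandT × (Option (List Bool) × (List (List Bool) × (List (List Bool × List ℕ) × List ℕ))))))))

/-- Its code. [folklore] -/
abbrev ftupleE : FTuple → List Bool :=
  pairE natE (pairE strE (pairE (rawE natE) (pairE (optE natE) (pairE (rawE natE) (pairE (optE candTE)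
    (pairE (optE strE) (pairE (rawE strE) (pairE (rawE (pairE strE (rawE natE))) (rawE natE)))))))))

/-- The record of a frame. [folklore] -/
def tupleOf : LFrame → FTuple
  | LFrame.indiv mask col cur xs best => (0, mask, col, cur, xs, best.map dataOfCand, none, [], [], [])
  | LFrame.sect mask col cur todo done => (1, mask, col, none, [], none, cur, todo, done, [])
  | LFrame.ret ord => (2, [], [], none, [], none, none, [], [], ord)

/-- **The code of a frame.** [cite: AroraBarakCC2009, §0.1] -/
def frameE : LFrame → List Bool := ftupleE ∘ tupleOf

/-- `dataOfCand` is injective. [folklore] -/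
theorem dataOfCand_injective : Function.Injective dataOfCand := Function.LeftInverse.injective candOfT_dataOfCand

/-- `tupleOf` is injective. [folklore] -/
theorem tupleOf_injective : Function.Injective tupleOf := by
  have hinj : Function.Injective (Option.map dataOfCand) := Option.map_injective dataOfCand_injective
  intro f g h
  cases f <;> cases g <;> simp [tupleOf] at h
  · obtain ⟨rfl, rfl, rfl, rfl, h⟩ := h; rw [hinj h]
  · obtain ⟨rfl, rfl, rfl, rfl, rfl⟩ := h; rfl
  · rw [h]

/-- The record of a frame, as a (transparent) typed map. [folklore] -/
theorem codeFP_tupleOf : CodeFP frameE ftupleE tupleOf := transparent fun _ => rfl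

/-- The code of an individualization frame. [folklore] -/
theorem frameE_indiv (mask : List Bool) (col : List ℕ) (cur : Option ℕ) (xs : List ℕ) (best : Option LCandT) :
    frameE (LFrame.indiv mask col cur xs (best.map candOfT)) = ftupleE (0, mask, col, cur, xs, best, none, [], [], []) := by
  simp [frameE, tupleOf, Option.map_map, show dataOfCand ∘ candOfT = id from funext dataOfCand_candOfT]

/-- The code of a section frame. [folklore] -/
theorem frameE_sect (mask : List Bool) (col : List ℕ) (cur : Option (List Bool)) (todo : List (List Bool)) (done : List (List Bool × List ℕ)) :
    frameE (LFrame.sect mask col cur todo done) = ftupleE (1, mask, col, none, [], none, cur, todo, done, []) := rfl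

/-- The code of a finished frame. [folklore] -/
theorem frameE_ret (ord : List ℕ) : frameE (LFrame.ret ord) = ftupleE (2, [], [], none, [], none, none, [], [], ord) := rfl

end CGProg

end Literature.Computability.Complexity
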